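import Summits.Ventures.AbcShadow.SH04.PairStatement
import Summits.Ventures.AbcShadow.SH04.LStar

/-!
# Venture AbcShadow — SH-04 STATEMENTS for [BVY04, Thm 1.7]: the pair `(p, n)` of `xⁿ + p^α yⁿ = 3^β z³` does not occur

HONEST FRAMING. Statement file of the work-bound cell `abc-shadow` (row SH-04, sub-rows "the two printed possibly-exceptional pairs
`(p, n) = (7, 13)` and `(13, 7)` of [BVY04, Thm 1.7]"; typer seat `abc-shadow-typ-1`, lineage g3). It PROVES NOTHING about any equation:
it types, as a plain `Prop` with parameters, `SH04Pair17 p n` := "for all `α ≥ 1`, `β ≥ 1` with `β` coprime to `3`, `xⁿ + p^α yⁿ = 3^β z³`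
has NO solution in pairwise coprime integers `x, y, z` with `|xy| > 1`" — the conclusion of the tree's rendering of the printed theorem
`Literature.NumberTheory.DiophantineGeometry.BennettVatsalYazdani2004.thm17` at one pair (same binder shape), and `Thm17With E` =
Theorem 1.7 with a VARIABLE exception set (`thm17With_printed`: at `E = {(7,13), (13,7)}` it is print's `thm17`), with the pure-logic
lemmas `sh04Pair17_of_thm17`, `thm17With_of_pairs`. Both printed pairs are CLOSED-by-us in the cell's census by the L\* route
(`SH04/LStar.lean`; crit-1-SH30.md f156d45a09d77339) — here the CM forms are the two rational newforms of level 243 (`j = 0`, CM by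
`ℚ(√−3)`): the certificate's `243.1` = the newform of `y² + y = x³ + 2` (congruent to the survivor `1701.18` modulo `(13, θ)`) and
`243.2` = the newform of `y² + y = x³ − 1` (congruent to the survivors `3159.8`, `3159.15` modulo `(7, θ)`) [certificate extension
j314368 part E2: "f = newform 243.1 … a_p(f) = 5 mod 13" at `p = 7`, "f = newform 243.2 … a_p(f) = 0 mod 7" at `p = 13` — matched by
`a₇ = 5` resp. `a₁₃ = −7` of these two curves, `cmCubicTrace_values`]. For the kernel SANITY SLICES of those congruences in the level files
`SH04/Level1701*.lean`, `SH04/Level3159*.lean`, this file also supplies `cmCubicTrace t q` = the trace of Frobenius of `y² + y = x³ + t`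
COMPUTED IN THE KERNEL by point counting (`cm27Trace = cmCubicTrace (−7)` is the 27a1 case of `SH04/LStar.lean`). ADJACENT results
(signature (n,n,3)), NOT abc: nothing here is a claim on the abc conjecture or on any summit; no side on IUT. AI-typed.
-/

namespace Summit.Ventures.AbcShadow

open Literature.NumberTheory.DiophantineGeometry.BennettVatsalYazdani2004 (thm17)

/-- **SH-04, generic [Thm 1.7] pair target** `SH04Pair17 p n`: for all `α ≥ 1` and `β ≥ 1` coprime to `3`, the equation
`xⁿ + p^α · yⁿ = 3^β · z³` has NO solution in pairwise coprime integers `x, y, z` with `|xy| > 1` — the conclusion of [BVY04, Thm 1.7] at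
the pair `(p, n)` (print asserts it for prime `n ≥ 7`, `p ∈ {7, 11, 13}`, unless, possibly, `(p, n) ∈ {(7,13), (13,7)}`). Plain `Prop`;
nothing is asserted. ADJACENT, NOT abc. [cite: BennettVatsalYazdani2004, Thm 1.7 pp.1400-1401 (conclusion at one pair (p, n))] -/
def SH04Pair17 (p n : ℕ) : Prop :=
  ∀ α β : ℕ, 0 < α → 0 < β → Nat.Coprime β 3 → ∀ x y z : ℤ, IsCoprime x y → IsCoprime x z → IsCoprime y z → 1 < |x * y| →
    x ^ n + (p : ℤ) ^ α * y ^ n ≠ 3 ^ β * z ^ 3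

/-- **What print gives** [cite: BennettVatsalYazdani2004, Thm 1.7 pp.1400-1401]: for prime `n ≥ 7` and `p ∈ {7, 11, 13}` with
`(p, n) ∉ {(7,13), (13,7)}`, Theorem 1.7 as printed is exactly `SH04Pair17 p n`. -/
theorem sh04Pair17_of_thm17 (h17 : thm17) {p n : ℕ} (hn : n.Prime) (h7 : 7 ≤ n) (hp : p ∈ ({7, 11, 13} : Finset ℕ))
    (he1 : ¬ (p = 7 ∧ n = 13)) (he2 : ¬ (p = 13 ∧ n = 7)) : SH04Pair17 p n :=
  fun α β hα hβ hβ3 x y z hxy hxz hyz hbig => h17 n hn h7 p hp α β hα hβ hβ3 he1 he2 x y z hxy hxz hyz hbig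

/-- **The exception set of [BVY04, Thm 1.7] as a parameter (pure logic).** `Thm17With E` := Theorem 1.7 as printed with the
possibly-exceptional pairs replaced by the finite set `E` (`thm17With_printed`: `E = {(7,13), (13,7)}` is print's `thm17`). Nothing is
asserted. [cite: BennettVatsalYazdani2004, Thm 1.7 pp.1400-1401 (statement with a variable exception list)] -/
def Thm17With (E : Finset (ℕ × ℕ)) : Prop :=
  ∀ n : ℕ, n.Prime → 7 ≤ n → ∀ p : ℕ, p ∈ ({7, 11, 13} : Finset ℕ) → ∀ α β : ℕ, 0 < α → 0 < β →
    Nat.Coprime β 3 → (p, n) ∉ E →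
    ∀ x y z : ℤ, IsCoprime x y → IsCoprime x z → IsCoprime y z → 1 < |x * y| →
    x ^ n + (p : ℤ) ^ α * y ^ n ≠ 3 ^ β * z ^ 3

/-- Print's Theorem 1.7 is `Thm17With {(7,13), (13,7)}` (pure logic: `(p, n) ∉ {(7,13), (13,7)}` ⇔ the two printed "unless" clauses).
[cite: BennettVatsalYazdani2004, Thm 1.7 pp.1400-1401] -/
theorem thm17With_printed : Thm17With {(7, 13), (13, 7)} ↔ thm17 := by
  constructor
  · intro h n hn h7 p hp α β hα hβ hβ3 he1 he2 x y z hxy hxz hyz hbig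
    refine h n hn h7 p hp α β hα hβ hβ3 ?_ x y z hxy hxz hyz hbig
    intro hmem
    simp only [Finset.mem_insert, Finset.mem_singleton, Prod.mk.injEq] at hmem
    rcases hmem with ⟨rfl, rfl⟩ | ⟨rfl, rfl⟩
    · exact he1 ⟨rfl, rfl⟩
    · exact he2 ⟨rfl, rfl⟩
  · intro h n hn h7 p hp α β hα hβ hβ3 hmem x y z hxy hxz hyz hbig
    refine h n hn h7 p hp α β hα hβ hβ3 ?_ ?_ x y z hxy hxz hyz hbig
    · rintro ⟨rfl, rfl⟩
      exact hmem (by simp)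
    · rintro ⟨rfl, rfl⟩
      exact hmem (by simp)

/-- **Striking closed pairs (pure logic).** If Theorem 1.7 holds with exception set `E` and every pair of `E` outside `E'` does not occur
(`SH04Pair17`), then Theorem 1.7 holds with exception set `E'`. [cite: BennettVatsalYazdani2004, Thm 1.7 pp.1400-1401] -/
theorem thm17With_of_pairs {E E' : Finset (ℕ × ℕ)} (hE : Thm17With E)
    (hclosed : ∀ pn ∈ E, pn ∉ E' → SH04Pair17 pn.1 pn.2) : Thm17With E' := by
  intro n hn h7 p hp α β hα hβ hβ3 hexc x y z hxy hxz hyz hbig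
  by_cases hmem : (p, n) ∈ E
  · exact hclosed (p, n) hmem hexc α β hα hβ hβ3 x y z hxy hxz hyz hbig
  · exact hE n hn h7 p hp α β hα hβ hβ3 hmem x y z hxy hxz hyz hbig

/-! ## Kernel bookkeeping: traces of the CM curves `y² + y = x³ + t` (level 27: `t = −7`; level 243: `t = 2`, `t = −1`) -/

/-- The trace of Frobenius `a_q` of the elliptic curve `y² + y = x³ + t` (`j = 0`, CM by `ℚ(√−3)`) at an odd prime `q`, COMPUTED IN THE
KERNEL by point counting: `y² + y = x³ + t ⇔ (2y + 1)² = 4x³ + 4t + 1`, so `a_q = −Σ_{x mod q} χ_q(4x³ + 4t + 1)` (Legendre symbol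
`legendreSymZ` of `SH04/BD10Package.lean`). `t = −7`: 27a1 (= `cm27Trace`); `t = 2`, `t = −1`: the two rational newforms of level 243
(the certificate's `243.1`, `243.2`). [folklore] -/
def cmCubicTrace (t : ℤ) (q : ℕ) : ℤ :=
  -(((List.range q).map fun x : ℕ => legendreSymZ (4 * (x : ℤ) ^ 3 + 4 * t + 1) q).sum)

/-- The traces of the two level-243 CM curves at the odd primes `5 ≤ q ≤ 37`, `q ≠ 3` (kernel evaluation): `y² + y = x³ + 2`:
`0, 5, 0, 2, 0, 8, 0, 0, −7, −1`; `y² + y = x³ − 1`: `0, −4, 0, −7, 0, −1, 0, 0, 11, −10` at `q = 5, 7, 11, 13, 17, 19, 23, 29, 31, 37`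
(`a_q = 0` at `q ≡ 2 (mod 3)`; `a₇ = 5 ≡ 5 (mod 13)` and `a₁₃ = −7 ≡ 0 (mod 7)` are the values the certificate extension j314368 part E2
prints for its `243.1` at `p = 7` and `243.2` at `p = 13`). [folklore] -/
theorem cmCubicTrace_values :
    ([5, 7, 11, 13, 17, 19, 23, 29, 31, 37] : List ℕ).map (cmCubicTrace 2) = [0, 5, 0, 2, 0, 8, 0, 0, -7, -1] ∧
      ([5, 7, 11, 13, 17, 19, 23, 29, 31, 37] : List ℕ).map (cmCubicTrace (-1)) = [0, -4, 0, -7, 0, -1, 0, 0, 11, -10] := by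
  constructor <;> decide +kernel

/-- `cm27Trace` of `SH04/LStar.lean` is the case `t = −7` (`4·(−7) + 1 = −27`). [folklore] -/
theorem cm27Trace_eq_cmCubicTrace (q : ℕ) : cm27Trace q = cmCubicTrace (-7) q := by
  simp only [cm27Trace, cmCubicTrace]
  congr 3
  funext x
  congr 1
  ring

end Summit.Ventures.AbcShadow
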